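import Summits.AtomisticToContinuum.HydrodynamicLimit.Theorems.JParityClosureLocalSecondLawLedgerIBP
import Summits.AtomisticToContinuum.HydrodynamicLimit.Theorems.InformationPercolationEngineKineticClosureDensity
import Literature.Analysis.FluidPDE.HardSphereCollisionRecord
import Literature.Analysis.FluidPDE.HardSphereRegularGeometry
import HarnessLib

/-!
# Kinetic reduction (crux `ChaosClosesEuler`, stmt-AtomisticToContinuum-15141, line `Sketch`,
# stub `stub_kineticReduction`) — helper: the momentum jump of ONE collision and Hardy's bond

WHAT. The collision term of Bogolyubov's exact weak equation for the cone-mollified momentum, tested against a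
vector field `G = (G₀, G₁, G₂)` on `𝕋³`, is a sum over collision times of the ordered-contact-pair sums of
`∑ₖ (∫ Gₖ b_r(xᵢ, ·)) (vᵢₖ − vᵢₖ⁻)`. For ONE ordered contact pair `(p, q)` of a configuration at distance `ε` this file
records the elementary kinematics (unit normal `n̂ = ε⁻¹(x_p − x_q)`, `x_p = x_q + εn̂`, the jump `v_p − v_p⁻ = ⟪v_p − v_q, n̂⟫ n̂`,
the reflected pair's normal relative speed, the swap `(p, q) ↔ (q, p)`), and the consequence of HARDY'S WEAK BOND
IDENTITY (`LocalSecondLawLedger.L.hardy_bond`): the two ordered pairs of one collision contribute together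
`⟪v_p − v_q, n̂⟫ · ε · ∑ₖₗ n̂ₖ n̂ₗ ∫ ∂ₗGₖ · b̄`, with `b̄ = bondC` the cone kernel averaged along the contact segment — NO
derivative falls on the cone, so every bound downstream is uniform in the mollification radius `r`. The same two
ordered pairs contribute `|⟪v_p − v_q, n̂⟫| ∑ₖₗ n̂ₖ n̂ₗ (aₖₗ(x_p) + aₖₗ(x_q))` to the collisional stress functional of
`CollisionalPressureValueInBand`. Also: `b̄ ≥ 0`, `∫ b̄ = 1`, `b̄` is continuous and supported within `r + ε` of both
centres, so `|∫ f b̄ − f(x_p)|`, `|∫ f b̄ − f(x_q)|` are controlled by the modulus of `f` at scale `r + ε`.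

REFERENCES. R. J. Hardy, J. Chem. Phys. 76 (1982) 622, eqs. (2.8)–(2.12); N. N. Bogolyubov, Theor. Math. Phys. 24
(1975) 804. No named fact is invoked.
-/

noncomputable section

namespace Summit.AtomisticToContinuum.HydrodynamicLimit.Theorems.ChaosClosesEulerReduction

open scoped BigOperators Topology Classical MeasureTheory ENNReal InnerProductSpace
open Filter Set MeasureTheory Function
open Literature.MathematicalPhysics.KineticTheory
open Literature.Analysis.FluidPDE
open Literature.Analysis.FunctionSpaces
open Summit.AtomisticToContinuum.HydrodynamicLimit.Theorems.LocalSecondLawNegative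
open Summit.AtomisticToContinuum.HydrodynamicLimit.Theorems.LocalSecondLawLedger

variable {N : ℕ}

/-! ## §1 Kinematics of one ordered contact pair -/

section Pair

variable {ε : ℝ} {w : Phase N} {p q : Fin (N + 1)}

/-- The unit normal has norm one at contact. [folklore] -/
theorem norm_nrm (hε : 0 < ε) (hn : ‖(Torus.geometry (Fin 3)).sepVec (w p).1 (w q).1‖ = ε) : ‖nrm ε w p q‖ = 1 := by
  unfold nrm
  rw [norm_smul, Real.norm_eq_abs, abs_of_pos (inv_pos.2 hε), hn, inv_mul_cancel₀ hε.ne']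

/-- Swapping the ordered pair flips the normal (minimal image, `ε < 1/2`). [folklore] -/
theorem nrm_swap (hG : (Torus.geometry (Fin 3)).IsHardSphereRegular ε)
    (hn : ‖(Torus.geometry (Fin 3)).sepVec (w p).1 (w q).1‖ = ε) : nrm ε w q p = -nrm ε w p q := by
  unfold nrm
  rw [hG.sepVec_comm _ _ hn.le, smul_neg]

/-- The products `n̂ₖ n̂ₗ` are the same for both orders of the pair. [folklore] -/
theorem nrm_mul_nrm_swap (hG : (Torus.geometry (Fin 3)).IsHardSphereRegular ε)
    (hn : ‖(Torus.geometry (Fin 3)).sepVec (w p).1 (w q).1‖ = ε) (k l : Fin 3) :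
    nrm ε w q p k * nrm ε w q p l = nrm ε w p q k * nrm ε w p q l := by
  rw [nrm_swap hG hn]
  simp

/-- **The contact geometry**: `x_p = x_q + proj (ε n̂)`. [folklore] -/
theorem pos_eq_add_proj (hε : 0 < ε) : (w p).1 = (w q).1 + Torus.proj (ε • nrm ε w p q) := by
  unfold nrm
  rw [smul_smul, mul_inv_cancel₀ hε.ne', one_smul, Torus.geometry_sepVec, Torus.proj_reprSym]
  abel

/-- The separation vector is `ε n̂`. [folklore] -/
theorem sepVec_eq_smul_nrm (hε : 0 < ε) : (Torus.geometry (Fin 3)).sepVec (w p).1 (w q).1 = ε • nrm ε w p q := by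
  unfold nrm
  rw [smul_smul, mul_inv_cancel₀ hε.ne', one_smul]

/-- **The momentum jump of the first particle**: `v_p − v_p⁻ = ⟪v_p − v_q, n̂⟫ n̂`. [folklore] -/
theorem vel_sub_vin_fst (hε : 0 < ε) (hn : ‖(Torus.geometry (Fin 3)).sepVec (w p).1 (w q).1‖ = ε) :
    (w p).2 - (vin w p q).1 = ⟪(w p).2 - (w q).2, nrm ε w p q⟫_ℝ • nrm ε w p q := by
  unfold vin reflectVel nrm
  simp only
  rw [sub_sub_cancel, hn, inner_smul_right, smul_smul]
  congr 1
  field_simp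

/-- The momentum jump of the second particle, read in the swapped order: `v_q − v_q⁻ = −⟪v_p − v_q, n̂⟫ n̂`. [folklore] -/
theorem vel_sub_vin_fst_swap (hε : 0 < ε) (hG : (Torus.geometry (Fin 3)).IsHardSphereRegular ε)
    (hn : ‖(Torus.geometry (Fin 3)).sepVec (w p).1 (w q).1‖ = ε) :
    (w q).2 - (vin w q p).1 = -(⟪(w p).2 - (w q).2, nrm ε w p q⟫_ℝ • nrm ε w p q) := by
  have hn' : ‖(Torus.geometry (Fin 3)).sepVec (w q).1 (w p).1‖ = ε := by
    rw [hG.sepVec_comm _ _ hn.le, norm_neg, hn]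
  rw [vel_sub_vin_fst hε hn', nrm_swap hG hn, inner_neg_right, ← neg_sub ((w p).2), inner_neg_left, neg_neg,
    smul_neg]

/-- **The normal relative speed of the recorded (pre-collisional) pair** is minus that of the post-collisional pair.
[folklore] -/
theorem inner_vin_sub (hε : 0 < ε) (hn : ‖(Torus.geometry (Fin 3)).sepVec (w p).1 (w q).1‖ = ε) :
    ⟪(vin w p q).1 - (vin w p q).2, nrm ε w p q⟫_ℝ = -⟪(w p).2 - (w q).2, nrm ε w p q⟫_ℝ := by
  have hne : (Torus.geometry (Fin 3)).sepVec (w p).1 (w q).1 ≠ 0 := by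
    intro h; rw [h, norm_zero] at hn; exact hε.ne' hn.symm
  have h := inner_reflectVel_fst_sub_snd _ hne ((w p).2, (w q).2)
  unfold vin nrm
  rw [inner_smul_right, inner_smul_right, real_inner_comm, h, real_inner_comm]
  ring

/-- The same in the swapped order, in absolute value. [folklore] -/
theorem abs_inner_vin_sub_swap (hε : 0 < ε) (hG : (Torus.geometry (Fin 3)).IsHardSphereRegular ε)
    (hn : ‖(Torus.geometry (Fin 3)).sepVec (w p).1 (w q).1‖ = ε) :
    |⟪(vin w q p).1 - (vin w q p).2, nrm ε w q p⟫_ℝ| = |⟪(w p).2 - (w q).2, nrm ε w p q⟫_ℝ| := by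
  have hn' : ‖(Torus.geometry (Fin 3)).sepVec (w q).1 (w p).1‖ = ε := by
    rw [hG.sepVec_comm _ _ hn.le, norm_neg, hn]
  rw [inner_vin_sub hε hn', nrm_swap hG hn, inner_neg_right, ← neg_sub ((w p).2), inner_neg_left]
  simp [abs_neg]

/-- The absolute normal relative speed of the recorded pair, first order. [folklore] -/
theorem abs_inner_vin_sub (hε : 0 < ε) (hn : ‖(Torus.geometry (Fin 3)).sepVec (w p).1 (w q).1‖ = ε) :
    |⟪(vin w p q).1 - (vin w p q).2, nrm ε w p q⟫_ℝ| = |⟪(w p).2 - (w q).2, nrm ε w p q⟫_ℝ| := by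
  rw [inner_vin_sub hε hn, abs_neg]

/-- The normal relative speed is at most `‖v_p‖ + ‖v_q‖ ≤ 1 + ‖v_p‖² + ‖v_q‖²`. [folklore] -/
theorem abs_inner_nrm_le (hε : 0 < ε) (hn : ‖(Torus.geometry (Fin 3)).sepVec (w p).1 (w q).1‖ = ε) :
    |⟪(w p).2 - (w q).2, nrm ε w p q⟫_ℝ| ≤ 1 + ‖(w p).2‖ ^ 2 + ‖(w q).2‖ ^ 2 := by
  have h1 : |⟪(w p).2 - (w q).2, nrm ε w p q⟫_ℝ| ≤ ‖(w p).2 - (w q).2‖ * ‖nrm ε w p q‖ := abs_real_inner_le_norm _ _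
  rw [norm_nrm hε hn, mul_one] at h1
  have h2 : ‖(w p).2 - (w q).2‖ ≤ ‖(w p).2‖ + ‖(w q).2‖ := norm_sub_le _ _
  nlinarith [sq_nonneg (‖(w p).2‖ - 1 / 2), sq_nonneg (‖(w q).2‖ - 1 / 2), norm_nonneg (w p).2, norm_nonneg (w q).2]

/-- `∑ₖₗ |n̂ₖ n̂ₗ| ≤ 3` for a unit vector of `ℝ³`. [folklore] -/
theorem sum_abs_nrm_mul_le (hε : 0 < ε) (hn : ‖(Torus.geometry (Fin 3)).sepVec (w p).1 (w q).1‖ = ε) :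
    ∑ k : Fin 3, ∑ l : Fin 3, |nrm ε w p q k * nrm ε w p q l| ≤ 3 := by
  have h1 : ∑ k : Fin 3, ∑ l : Fin 3, |nrm ε w p q k * nrm ε w p q l| = (∑ k : Fin 3, |nrm ε w p q k|) ^ 2 := by
    rw [sq, Finset.sum_mul_sum]
    refine Finset.sum_congr rfl fun k _ => Finset.sum_congr rfl fun l _ => abs_mul _ _
  have h2 : ‖nrm ε w p q‖ ^ 2 = ∑ k : Fin 3, nrm ε w p q k ^ 2 := L.norm_sq_eq_sum _
  rw [norm_nrm hε hn, one_pow, Fin.sum_univ_three] at h2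
  rw [h1, Fin.sum_univ_three, ← sq_abs (nrm ε w p q 0), ← sq_abs (nrm ε w p q 1), ← sq_abs (nrm ε w p q 2)] at *
  nlinarith [sq_nonneg (|nrm ε w p q 0| - |nrm ε w p q 1|), sq_nonneg (|nrm ε w p q 1| - |nrm ε w p q 2|),
    sq_nonneg (|nrm ε w p q 0| - |nrm ε w p q 2|), h2]

end Pair

/-! ## §2 The bond average of the cone kernel -/

section Bond

variable {r : ℝ} (hr : 0 < r) (w : Phase N) (p q : Fin (N + 1))
include hr

/-- The bond average is nonnegative. [folklore] -/
theorem bondC_nonneg (x : T3) : 0 ≤ bondC r w p q x :=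
  setIntegral_nonneg measurableSet_Icc fun _ _ => cone_nonneg hr _ _

/-- The bond average is continuous in the field point. [folklore] -/
theorem continuous_bondC : Continuous (bondC r w p q) := by
  set v : V3 := (Torus.geometry (Fin 3)).sepVec (w p).1 (w q).1 with hv
  have hc := L.continuous_cone_displaced hr (w q).1 v
  have hsw : Continuous fun z : T3 × ℝ => ((z.2, z.1) : ℝ × T3) := by fun_prop
  have hc' : Continuous fun z : T3 × ℝ => cone r ((w q).1 + Torus.proj (z.2 • v)) z.1 :=
    Continuous.comp (g := fun pp : ℝ × T3 => cone r ((w q).1 + Torus.proj (pp.1 • v)) pp.2)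
      (f := fun z : T3 × ℝ => ((z.2, z.1) : ℝ × T3)) hc hsw
  have key : Continuous fun x : T3 => ∫ l in Set.Icc (0 : ℝ) 1, cone r ((w q).1 + Torus.proj (l • v)) x :=
    continuous_parametric_integral_of_continuous (μ := (volume : Measure ℝ))
      (f := fun (x : T3) (l : ℝ) => cone r ((w q).1 + Torus.proj (l • v)) x) hc' (s := Set.Icc (0 : ℝ) 1) isCompact_Icc
  exact key

/-- The bond average is bounded by the cone peak. [folklore] -/
theorem bondC_le (x : T3) : bondC r w p q x ≤ 3 / (Real.pi * r ^ 3) := by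
  unfold bondC
  have hc := L.continuous_cone_displaced hr (w q).1 ((Torus.geometry (Fin 3)).sepVec (w p).1 (w q).1)
  have hi : IntegrableOn (fun l : ℝ => cone r ((w q).1 + Torus.proj (l • (Torus.geometry (Fin 3)).sepVec (w p).1 (w q).1)) x)
      (Set.Icc 0 1) volume := (hc.comp (continuous_id.prodMk continuous_const)).integrableOn_Icc
  have h1 := norm_setIntegral_le_of_norm_le_const (μ := (volume : Measure ℝ)) (s := Set.Icc (0 : ℝ) 1)
    (measure_Icc_lt_top (a := (0 : ℝ)) (b := 1))
    (fun l _ => show ‖cone r ((w q).1 + Torus.proj (l • (Torus.geometry (Fin 3)).sepVec (w p).1 (w q).1)) x‖ ≤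
      3 / (Real.pi * r ^ 3) by
      rw [Real.norm_eq_abs]; exact L.abs_cone_le hr _ _)
  rw [Real.norm_eq_abs, measureReal_def, Real.volume_Icc, sub_zero, ENNReal.toReal_ofReal zero_le_one, mul_one] at h1
  exact (le_abs_self _).trans h1

/-- **The bond average integrates to one** (`r ≤ 1/2`; Fubini, unit mass of the cone). [folklore] -/
theorem integral_bondC (hr2 : r ≤ 1 / 2) : ∫ x, bondC r w p q x = 1 := by
  unfold bondC
  set v : V3 := (Torus.geometry (Fin 3)).sepVec (w p).1 (w q).1 with hv
  have hc := L.continuous_cone_displaced hr (w q).1 v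
  have hswap : ∫ x, (∫ l in Set.Icc (0 : ℝ) 1, cone r ((w q).1 + Torus.proj (l • v)) x) =
      ∫ l in Set.Icc (0 : ℝ) 1, ∫ x, cone r ((w q).1 + Torus.proj (l • v)) x := by
    refine (integral_integral_swap ?_).symm
    refine Integrable.mono' (integrable_const (3 / (Real.pi * r ^ 3))) ?_ ?_
    · exact hc.aestronglyMeasurable
    · exact Filter.Eventually.of_forall fun z => by
        rw [Function.uncurry_def, Real.norm_eq_abs, abs_of_nonneg (cone_nonneg hr _ _)]
        exact DensityCapNegative.cone_le hr _ _
  change ∫ x, (∫ l in Set.Icc (0 : ℝ) 1, cone r ((w q).1 + Torus.proj (l • v)) x) = 1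
  rw [hswap]
  have hone : ∀ l : ℝ, ∫ x, cone r ((w q).1 + Torus.proj (l • v)) x = 1 := fun l =>
    KineticClosureDensity.integral_cone_eq_one' hr hr2 _
  simp_rw [hone]
  rw [setIntegral_const, measureReal_def, Real.volume_Icc, sub_zero, ENNReal.toReal_ofReal zero_le_one, one_smul]

/-- **Support of the bond average**: if `b̄(x) ≠ 0` then `x` is within `r + ‖x_p − x_q‖` of `x_q` and of
`x_q + proj (x_p − x_q)` (= `x_p` at contact). [folklore] -/
theorem euclidDist_lt_of_bondC_ne_zero {x : T3} (h : bondC r w p q x ≠ 0) :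
    Torus.euclidDist x (w q).1 < r + ‖(Torus.geometry (Fin 3)).sepVec (w p).1 (w q).1‖ ∧
    Torus.euclidDist x ((w q).1 + Torus.proj ((Torus.geometry (Fin 3)).sepVec (w p).1 (w q).1)) <
      r + ‖(Torus.geometry (Fin 3)).sepVec (w p).1 (w q).1‖ := by
  set v : V3 := (Torus.geometry (Fin 3)).sepVec (w p).1 (w q).1 with hv
  -- some point of the segment carries a nonzero kernel
  obtain ⟨l, hl, hne⟩ : ∃ l ∈ Set.Icc (0 : ℝ) 1, cone r ((w q).1 + Torus.proj (l • v)) x ≠ 0 := by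
    by_contra hall
    push Not at hall
    exact h (setIntegral_eq_zero_of_forall_eq_zero hall)
  have hd : Torus.euclidDist ((w q).1 + Torus.proj (l • v)) x < r := by
    by_contra hge
    exact hne (DensityCapNegative.cone_eq_zero_of_le hr (not_lt.1 hge))
  have hd' : Torus.euclidDist x ((w q).1 + Torus.proj (l • v)) < r := by rwa [Torus.euclidDist_comm]
  have hv0 : ‖l • v‖ ≤ ‖v‖ := by
    rw [norm_smul, Real.norm_eq_abs, abs_of_nonneg hl.1]; exact mul_le_of_le_one_left (norm_nonneg _) hl.2
  have hv1 : ‖l • v - v‖ ≤ ‖v‖ := by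
    rw [show l • v - v = (l - 1) • v by rw [sub_smul, one_smul], norm_smul, Real.norm_eq_abs,
      abs_of_nonpos (by linarith [hl.2]), neg_sub]
    exact mul_le_of_le_one_left (norm_nonneg _) (by linarith [hl.1])
  constructor
  · have h1 : Torus.euclidDist ((w q).1 + Torus.proj (l • v)) (w q).1 ≤ ‖l • v‖ := by
      have := euclidDist_add_proj_le' (w q).1 (l • v) 0
      simpa using this
    have := euclidDist_triangle x ((w q).1 + Torus.proj (l • v)) (w q).1
    linarith
  · have h1 : Torus.euclidDist ((w q).1 + Torus.proj (l • v)) ((w q).1 + Torus.proj v) ≤ ‖l • v - v‖ :=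
      euclidDist_add_proj_le' (w q).1 (l • v) v
    have := euclidDist_triangle x ((w q).1 + Torus.proj (l • v)) ((w q).1 + Torus.proj v)
    linarith
where
  /-- Two translates of one point are at minimal-image distance at most the distance of the displacements. -/
  euclidDist_add_proj_le' (y : T3) (a b : V3) : Torus.euclidDist (y + Torus.proj a) (y + Torus.proj b) ≤ ‖a - b‖ := by
    obtain ⟨c, hc⟩ := Torus.proj_surjective y
    have h1 : y + Torus.proj a = Torus.proj (c + a) := by rw [Torus.proj_add, hc]
    have h2 : y + Torus.proj b = Torus.proj (c + b) := by rw [Torus.proj_add, hc]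
    rw [h1, h2]
    refine (Torus.euclidDist_proj_le_norm_sub_holds _ _).trans (le_of_eq ?_)
    congr 1; abel

/-- **Averaging against the bond**: if `|f x − f y| ≤ ω` whenever `x` is within `r + ‖x_p − x_q‖` of `y`, for `y` one
of the two end points of the segment, then `|∫ f b̄ − f y| ≤ ω` (`r ≤ 1/2`, `f` continuous). [folklore] -/
theorem abs_integral_mul_bondC_sub_le (hr2 : r ≤ 1 / 2) {f : T3 → ℝ} (hf : Continuous f) {y : T3}
    (hy : y = (w q).1 ∨ y = (w q).1 + Torus.proj ((Torus.geometry (Fin 3)).sepVec (w p).1 (w q).1)) {ω : ℝ}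
    (hω : ∀ x, Torus.euclidDist x y < r + ‖(Torus.geometry (Fin 3)).sepVec (w p).1 (w q).1‖ → |f x - f y| ≤ ω) :
    |(∫ x, f x * bondC r w p q x) - f y| ≤ ω := by
  have hbc := continuous_bondC hr w p q
  have hint : Integrable (fun x => f x * bondC r w p q x) volume := (hf.mul hbc).integrable_unitAddTorus
  have hint1 : Integrable (bondC r w p q) volume := hbc.integrable_unitAddTorus
  have heq : (∫ x, f x * bondC r w p q x) - f y = ∫ x, (f x - f y) * bondC r w p q x := by
    have h1 : ∫ x, (f x - f y) * bondC r w p q x = (∫ x, f x * bondC r w p q x) - ∫ x, f y * bondC r w p q x := by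
      rw [← integral_sub hint (hint1.const_mul (f y))]
      exact integral_congr_ae (ae_of_all _ fun x => by ring)
    rw [h1, integral_const_mul, integral_bondC hr w p q hr2, mul_one]
  rw [heq]
  have hpt : ∀ x, |(f x - f y) * bondC r w p q x| ≤ ω * bondC r w p q x := by
    intro x
    rw [abs_mul, abs_of_nonneg (bondC_nonneg hr w p q x)]
    by_cases hb : bondC r w p q x = 0
    · rw [hb, mul_zero, mul_zero]
    · refine mul_le_mul_of_nonneg_right (hω x ?_) (bondC_nonneg hr w p q x)
      rcases hy with rfl | rfl
      · exact (euclidDist_lt_of_bondC_ne_zero hr w p q hb).1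
      · exact (euclidDist_lt_of_bondC_ne_zero hr w p q hb).2
  calc |∫ x, (f x - f y) * bondC r w p q x| ≤ ∫ x, ω * bondC r w p q x := by
        rw [← Real.norm_eq_abs]
        exact norm_integral_le_of_norm_le (hint1.const_mul _) (ae_of_all _ fun x => by rw [Real.norm_eq_abs]; exact hpt x)
    _ = ω := by rw [integral_const_mul, integral_bondC hr w p q hr2, mul_one]

end Bond

/-! ## §3 Hardy's bond identity for the two kernels of a contact pair -/

/-- **Hardy for one contact pair**: for Lipschitz `G`,
`∫ G b_r(x_p, ·) − ∫ G b_r(x_q, ·) = ε ∑ₗ n̂ₗ ∫ ∂ₗG · b̄` when `‖x_p − x_q‖ = ε`. [folklore] -/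
theorem integral_mul_cone_sub_eq {ε r : ℝ} (hε : 0 < ε) (hr : 0 < r) {w : Phase N} {p q : Fin (N + 1)}
    {G : T3 → ℝ} {K : NNReal} (hG : LipschitzWith K G) :
    (∫ x, G x * cone r (w p).1 x) - ∫ x, G x * cone r (w q).1 x =
      ε * ∑ l : Fin 3, nrm ε w p q l * ∫ x, pD l G x * bondC r w p q x := by
  set v : V3 := (Torus.geometry (Fin 3)).sepVec (w p).1 (w q).1 with hv
  have hGc : Continuous G := hG.continuous
  have hpos : (w p).1 = (w q).1 + Torus.proj v := by
    rw [hv, Torus.geometry_sepVec, Torus.proj_reprSym]; abel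
  have hH := L.hardy_bond hG hr (w q).1 v
  rw [← hpos] at hH
  have hi1 : Integrable (fun x => G x * cone r (w p).1 x) volume := (hGc.mul (continuous_cone r _)).integrable_unitAddTorus
  have hi2 : Integrable (fun x => G x * cone r (w q).1 x) volume := (hGc.mul (continuous_cone r _)).integrable_unitAddTorus
  have hL : (∫ x, G x * cone r (w p).1 x) - ∫ x, G x * cone r (w q).1 x =
      ∫ x, G x * (cone r (w p).1 x - cone r (w q).1 x) := by
    rw [← integral_sub hi1 hi2]
    exact integral_congr_ae (ae_of_all _ fun x => by ring)
  rw [hL, hH]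
  -- linearity of the right-hand side
  have hbond : ∀ x, (∫ l in Set.Icc (0 : ℝ) 1, cone r ((w q).1 + Torus.proj (l • v)) x) = bondC r w p q x := fun x => rfl
  simp_rw [hbond]
  have hint : ∀ l : Fin 3, Integrable (fun x => pD l G x * bondC r w p q x) volume := fun l =>
    Integrable.mono' (integrable_const ((K : ℝ) * (3 / (Real.pi * r ^ 3))))
      (((L.measurable_pD l hGc).mul (continuous_bondC hr w p q).measurable).aestronglyMeasurable)
      (Filter.Eventually.of_forall fun x => by
        rw [Real.norm_eq_abs, abs_mul, abs_of_nonneg (bondC_nonneg hr w p q x)]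
        exact mul_le_mul (L.abs_pD_le hG l x) (bondC_le hr w p q x) (bondC_nonneg hr w p q x) (NNReal.coe_nonneg K))
  have hexp : ∀ x, (∑ k : Fin 3, v k * pD k G x) * bondC r w p q x =
      ∑ k : Fin 3, (ε * nrm ε w p q k) * (pD k G x * bondC r w p q x) := by
    intro x
    rw [Finset.sum_mul]
    refine Finset.sum_congr rfl fun k _ => ?_
    have hvk : v k = ε * nrm ε w p q k := by
      rw [hv, sepVec_eq_smul_nrm hε]; simp
    rw [hvk]; ring
  simp_rw [hexp]
  rw [integral_finsetSum _ fun k _ => (hint k).const_mul _, Finset.mul_sum]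
  refine Finset.sum_congr rfl fun k _ => ?_
  rw [integral_const_mul]; ring

/-! ## §4 The two ordered pairs of one collision -/

/-- **The momentum jump of the two ordered pairs of one collision, tested against `G`, through Hardy's bond**:
`∑ over (p,q),(q,p) of ∑ₖ (∫ Gₖ b_r(xᵢ,·)) (vᵢₖ − vᵢₖ⁻) = ⟪v_p − v_q, n̂⟫ · ε · ∑ₖₗ n̂ₖ n̂ₗ ∫ ∂ₗGₖ · b̄`. [folklore] -/
theorem jump_pair_eq {ε r : ℝ} (hε : 0 < ε) (hr : 0 < r) (hG : (Torus.geometry (Fin 3)).IsHardSphereRegular ε)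
    {w : Phase N} {p q : Fin (N + 1)} (hn : ‖(Torus.geometry (Fin 3)).sepVec (w p).1 (w q).1‖ = ε)
    (Gf : Fin 3 → T3 → ℝ) (hGf : ∀ k, ∃ K : NNReal, LipschitzWith K (Gf k)) :
    (∑ k : Fin 3, (∫ x, Gf k x * cone r (w p).1 x) * ((w p).2 k - (vin w p q).1 k)) +
      ∑ k : Fin 3, (∫ x, Gf k x * cone r (w q).1 x) * ((w q).2 k - (vin w q p).1 k) =
    ⟪(w p).2 - (w q).2, nrm ε w p q⟫_ℝ * ε *
      ∑ k : Fin 3, ∑ l : Fin 3, nrm ε w p q k * nrm ε w p q l * ∫ x, pD l (Gf k) x * bondC r w p q x := by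
  have hj1 : ∀ k : Fin 3, (w p).2 k - (vin w p q).1 k = ⟪(w p).2 - (w q).2, nrm ε w p q⟫_ℝ * nrm ε w p q k := by
    intro k
    have h := congrArg (fun z : V3 => z k) (vel_sub_vin_fst (w := w) hε hn)
    simpa using h
  have hj2 : ∀ k : Fin 3, (w q).2 k - (vin w q p).1 k = -(⟪(w p).2 - (w q).2, nrm ε w p q⟫_ℝ * nrm ε w p q k) := by
    intro k
    have h := congrArg (fun z : V3 => z k) (vel_sub_vin_fst_swap (w := w) hε hG hn)
    simpa using h
  simp_rw [hj1, hj2, ← Finset.sum_add_distrib]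
  have hstep : ∀ k : Fin 3, (∫ x, Gf k x * cone r (w p).1 x) * (⟪(w p).2 - (w q).2, nrm ε w p q⟫_ℝ * nrm ε w p q k) +
      (∫ x, Gf k x * cone r (w q).1 x) * -(⟪(w p).2 - (w q).2, nrm ε w p q⟫_ℝ * nrm ε w p q k) =
      ⟪(w p).2 - (w q).2, nrm ε w p q⟫_ℝ * ε *
        ∑ l : Fin 3, nrm ε w p q k * nrm ε w p q l * ∫ x, pD l (Gf k) x * bondC r w p q x := by
    intro k
    obtain ⟨K, hK⟩ := hGf k
    have h := integral_mul_cone_sub_eq (w := w) (p := p) (q := q) hε hr hK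
    have h' : (∫ x, Gf k x * cone r (w p).1 x) * (⟪(w p).2 - (w q).2, nrm ε w p q⟫_ℝ * nrm ε w p q k) +
        (∫ x, Gf k x * cone r (w q).1 x) * -(⟪(w p).2 - (w q).2, nrm ε w p q⟫_ℝ * nrm ε w p q k) =
        ⟪(w p).2 - (w q).2, nrm ε w p q⟫_ℝ * nrm ε w p q k *
          ((∫ x, Gf k x * cone r (w p).1 x) - ∫ x, Gf k x * cone r (w q).1 x) := by ring
    rw [h', h, Finset.mul_sum, Finset.mul_sum, Finset.mul_sum]
    refine Finset.sum_congr rfl fun l _ => by ring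
  simp_rw [hstep, ← Finset.mul_sum]

/-- **The collisional stress mark of the two ordered pairs of one collision**:
`∑ over (p,q),(q,p) of |⟪vᵢ⁻ − vⱼ⁻, n̂ᵢⱼ⟫| ∑ₖₗ aₖₗ(xᵢ) n̂ₖ n̂ₗ = |⟪v_p − v_q, n̂⟫| ∑ₖₗ n̂ₖ n̂ₗ (aₖₗ(x_p) + aₖₗ(x_q))`. [folklore] -/
theorem stress_pair_eq {ε : ℝ} (hε : 0 < ε) (hG : (Torus.geometry (Fin 3)).IsHardSphereRegular ε)
    {w : Phase N} {p q : Fin (N + 1)} (hn : ‖(Torus.geometry (Fin 3)).sepVec (w p).1 (w q).1‖ = ε)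
    (a : Fin 3 → Fin 3 → T3 → ℝ) :
    |⟪(vin w p q).1 - (vin w p q).2, nrm ε w p q⟫_ℝ| * ∑ k : Fin 3, ∑ l : Fin 3, a k l (w p).1 * (nrm ε w p q k * nrm ε w p q l) +
      |⟪(vin w q p).1 - (vin w q p).2, nrm ε w q p⟫_ℝ| * ∑ k : Fin 3, ∑ l : Fin 3, a k l (w q).1 * (nrm ε w q p k * nrm ε w q p l) =
    |⟪(w p).2 - (w q).2, nrm ε w p q⟫_ℝ| *
      ∑ k : Fin 3, ∑ l : Fin 3, nrm ε w p q k * nrm ε w p q l * (a k l (w p).1 + a k l (w q).1) := by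
  rw [abs_inner_vin_sub hε hn, abs_inner_vin_sub_swap hε hG hn]
  simp_rw [nrm_mul_nrm_swap hG hn, ← mul_add, ← Finset.sum_add_distrib]
  congr 1
  refine Finset.sum_congr rfl fun k _ => Finset.sum_congr rfl fun l _ => by ring

/-- **Symmetric weights see only the symmetric part**: `∑ₖₗ n̂ₖn̂ₗ (Aₖₗ + Aₗₖ)/2 = ∑ₖₗ n̂ₖn̂ₗ Aₖₗ`. [folklore] -/
theorem sum_nrm_symm (n : V3) (A : Fin 3 → Fin 3 → ℝ) :
    ∑ k : Fin 3, ∑ l : Fin 3, n k * n l * ((A k l + A l k) / 2) = ∑ k : Fin 3, ∑ l : Fin 3, n k * n l * A k l := by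
  have h : ∑ k : Fin 3, ∑ l : Fin 3, n k * n l * A l k = ∑ k : Fin 3, ∑ l : Fin 3, n k * n l * A k l := by
    rw [Finset.sum_comm]
    refine Finset.sum_congr rfl fun k _ => Finset.sum_congr rfl fun l _ => by ring
  have h2 : ∑ k : Fin 3, ∑ l : Fin 3, n k * n l * ((A k l + A l k) / 2) =
      (∑ k : Fin 3, ∑ l : Fin 3, n k * n l * A k l + ∑ k : Fin 3, ∑ l : Fin 3, n k * n l * A l k) / 2 := by
    rw [← Finset.sum_add_distrib, Finset.sum_div]
    refine Finset.sum_congr rfl fun k _ => ?_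
    rw [← Finset.sum_add_distrib, Finset.sum_div]
    refine Finset.sum_congr rfl fun l _ => by ring
  rw [h2, h]; ring

/-! ## §5 The registered sub-goal -/

/-- **Registered sub-goal `stub_reductionHardy` (helper of `stub_kineticReduction`): the momentum jump of the first
particle of an ordered contact pair is `⟪v_p − v_q, n̂⟫ n̂`** (elastic reflection law read through the route's
`vin`/`nrm` vocabulary). [folklore] -/
theorem stub_reductionHardy : ∀ {N : ℕ} {ε : ℝ} {w : Config (N + 1) (Fin 3) T3} {p q : Fin (N + 1)}, 0 < ε → ‖(Torus.geometry (Fin 3)).sepVec (w p).1 (w q).1‖ = ε → (w p).2 - (vin w p q).1 = ⟪(w p).2 - (w q).2, nrm ε w p q⟫_ℝ • nrm ε w p q :=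
  fun hε hn => vel_sub_vin_fst hε hn

end Summit.AtomisticToContinuum.HydrodynamicLimit.Theorems.ChaosClosesEulerReduction

end
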